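import Literature.IUT.LogVolume.GenuineLogThetaPoint
import HarnessLib

/-!
# [IUTchIV] Cor. 2.2 (ii) proof (P7): the predicate `Cor22.ThetaDataExistsAt P l` (FACT-LIST F-2786) is a SCHEMA in `l` —
# its universal closure is refutable at every non-admissible `l`; the instance form at admissible `(P, l)` is the landed stub

S. Mochizuki, *Inter-universal Teichmüller Theory IV*, kurims manuscript (April 2020), §2, proof of
Corollary 2.2 (ii), (P7), p. 46 [cite: Mochizuki2012, IUTchIV Cor. 2.2 (ii) proof p. 46] (D-0012 claim key):
"there exist data … such that all of the conditions of [IUTchI], Definition 3.1, (a), (b), (c), (d), (e), (f),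
are satisfied" — for the prime `l` CHOSEN in (P1) (in particular `l ≥ 5` prime, [IUTchI] Def. 3.1 (c)).

Negative knowledge recorded next to `GenuineLogThetaPoint.lean` (abc-iut-S-d2 / plan definition request
`defn-NegLogThetaAtDatum`), PROOF-ONLY (no definitions, no instances), abc-iut cell seat abc-iut-w5-d239
(F-TRANCHES tranche 198, `ledger fact claim` of record).

The typed predicate `ThetaDataExistsAt P l := Nonempty (ThetaVolumeDatumAt P l)` quantifies over an ARBITRARY
natural number `l`, while every inhabitant carries a collection of initial Θ-data
`D : InitialThetaData F K Fbar E l Pb` whose fields `l_prime : l.Prime` and `five_le_l : 5 ≤ l` quote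
[IUTchI] Def. 3.1 (c) "`l ≥ 5` is a prime number".  Hence the type is EMPTY at every `l < 5` and at every
composite `l`, and the universal closure `∀ P l, ThetaDataExistsAt P l` is false (witness: the point
`(ℚ, 0)` of the `λ`-line and `l = 4`).  This file supplies the kernel objects

* `not_thetaDataExistsAt_of_lt_five`   — `l < 5 ⇒ ¬ ThetaDataExistsAt P l`, for every `P`;
* `not_thetaDataExistsAt_of_not_prime`  — `¬ l.Prime ⇒ ¬ ThetaDataExistsAt P l`, for every `P`;
* `thetaDataExistsAt_imp_prime_and_five_le` — the admissibility side condition any inhabitant forces;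
* `not_forall_thetaDataExistsAt`        — the fully quantified closure is false.

The INSTANCE FORM the text prints — existence at an ADMISSIBLE pair `(P, l)` (P minimal, `l ≥ 5` prime, the
(P1)/(P2)/(P5)/(P6) conditions) — is the registered stub of the crux `ThetaPartII`, LANDED in tree as
`Summit.ABC.ABC.Theorems.ThetaPartII.stub_thetaData` (`Summits/ABC/ABC/Theorems/IUTThetaPilotThetaPartIIStubThetaData.lean`)
over `Literature.IUT.LogVolume.Cor22.thetaDataExistsAt_of_condP6_thetaClosure`
(`Corollary22ThetaClosureData.lean`).  So F-2786 is admissible ONLY in that instance form (FACT-LIST class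
«universal-closure REFUTED / schema; instance form PROVED»).  Classical bookkeeping about the typing;
nothing here bears on the disputed [IUTchIII] Cor. 3.12 or takes a side; a refuted closure is a statement
about the binder `l`, not about the paper.
-/

namespace Literature.IUT.LogVolume

namespace Cor22

open Literature.NumberTheory.DiophantineGeometry.GenEll

/-- Every genuine Θ-volume datum at `(P, l)` carries [IUTchI] Def. 3.1 (c): `l` is a prime `≥ 5`.
[cite: Mochizuki2012, IUTchIV Cor. 2.2 (ii) proof p. 46] -/
theorem ThetaVolumeDatumAt.prime_and_five_le {P : NFPoint} {l : ℕ} (T : ThetaVolumeDatumAt P l) :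
    l.Prime ∧ 5 ≤ l := by
  letI := T.instFieldF; letI := T.instNumberFieldF; letI := T.instFieldK; letI := T.instNumberFieldK
  letI := T.instAlgebraK; letI := T.instAlgebraF; letI := T.instFieldFbar; letI := T.instAlgebraFbar
  letI := T.instAlgebraKFbar; letI := T.instIsElliptic
  exact ⟨T.D.l_prime, T.D.five_le_l⟩

/-- An inhabitant of `ThetaDataExistsAt P l` forces the admissibility side condition `l.Prime ∧ 5 ≤ l`
([IUTchI] Def. 3.1 (c), carried by the datum's `InitialThetaData`).
[cite: Mochizuki2012, IUTchIV Cor. 2.2 (ii) proof p. 46] -/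
theorem thetaDataExistsAt_imp_prime_and_five_le {P : NFPoint} {l : ℕ} (h : ThetaDataExistsAt P l) :
    l.Prime ∧ 5 ≤ l := by
  obtain ⟨T⟩ := h
  exact T.prime_and_five_le

/-- **F-2786 is a schema in `l`**: for `l < 5` there is NO genuine Θ-volume datum at `(P, l)`, whatever the
point `P` ([IUTchI] Def. 3.1 (c) requires `l ≥ 5`). [cite: Mochizuki2012, IUTchIV Cor. 2.2 (ii) proof p. 46] -/
theorem not_thetaDataExistsAt_of_lt_five {P : NFPoint} {l : ℕ} (hl : l < 5) : ¬ ThetaDataExistsAt P l :=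
  fun h => absurd (thetaDataExistsAt_imp_prime_and_five_le h).2 (not_le.mpr hl)

/-- **F-2786 is a schema in `l`**: for composite (or `≤ 1`) `l` there is NO genuine Θ-volume datum at `(P, l)`
([IUTchI] Def. 3.1 (c) requires `l` prime). [cite: Mochizuki2012, IUTchIV Cor. 2.2 (ii) proof p. 46] -/
theorem not_thetaDataExistsAt_of_not_prime {P : NFPoint} {l : ℕ} (hl : ¬ l.Prime) :
    ¬ ThetaDataExistsAt P l :=
  fun h => hl (thetaDataExistsAt_imp_prime_and_five_le h).1

/-- At EVERY point `P` of the `λ`-line some `l` violates `ThetaDataExistsAt P l` (namely `l = 4`): the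
predicate is a genuine hypothesis on `l`, not a property of the point alone.
[cite: Mochizuki2012, IUTchIV Cor. 2.2 (ii) proof p. 46] -/
theorem exists_not_thetaDataExistsAt (P : NFPoint) : ∃ l : ℕ, ¬ ThetaDataExistsAt P l :=
  ⟨4, not_thetaDataExistsAt_of_lt_five (by norm_num)⟩

/-- **The universal closure of F-2786 is false** (witness: the rational point `λ = 0` presented over `ℚ`,
and `l = 4`); the printed statement is the instance at the (P1) prime, which is the landed stub
`stub_thetaData` of the crux `ThetaPartII`. [cite: Mochizuki2012, IUTchIV Cor. 2.2 (ii) proof p. 46] -/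
theorem not_forall_thetaDataExistsAt : ¬ ∀ (P : NFPoint) (l : ℕ), ThetaDataExistsAt P l :=
  fun h => not_thetaDataExistsAt_of_lt_five (P := { F := ℚ, x := 0 }) (l := 4) (by norm_num) (h _ 4)

end Cor22

end Literature.IUT.LogVolume
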